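import Summits.NavierStokesRegularity.NavierStokesRegularity.Theorems.StrainDoorsDSSPackageGeometry
import HarnessLib

/-!
# StrainDoorsEulerAndTangentDoor — the viscosity-free reading of the record laws, and the tangent-flow door D14

nsreg-p1 g35, ROUND-56 PART F (helper lane of `stmt-NavierStokesRegularity-0056`, rung N0; lands after PART E
`StrainDoorsDSSPackageGeometry`).

§1 PRESSURE-FREE VORTICITY RECORD LAW.  ROUND 53's vorticity record law used the classical solution `(u, p)` only
through the vorticity formulation.  `vorticity_record_law_of_vorticitySolution` restates it for ANY
`IsVorticitySolutionOn S ν u` (`∂ₜω + (u·∇)ω = (ω·∇)u + νΔω`, `div u = 0`, jointly smooth; no pressure, any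
`ν ≥ 0`): at a running space-time record of `(T − t)|ω|` with `ω ≠ 0`, `1 ≤ (T − t)(α − ν|∇ξ|²_F)`.  This is the
form the KNSS representative fields `U` (velocity modulo a drift `b(t)`) and the Euler vorticity formulation satisfy.

§2 THE EULER READING (`ν = 0`).  The DSS record laws of ROUND 53 were proved for every `ν ≥ 0`; at `ν = 0` they
say: a `c`-DSS classical EULER solution on `(−∞,0) × ℝ³` whose gradient decays at spatial infinity on one period
slab and whose vorticity is not identically zero ATTAINS its vorticity number at a point where the stretching rate
is AT LEAST THE CLOCK, `(0 − t)·α(t,x) ≥ 1` exactly (`euler_dss_vorticity_record_law`), and attains its strain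
number `N* ≥ 1` at a point where `N + N² ≤ (0 − t)²·(¼(|ω|² − ⟪ω,e⟫²) − ∂²p/∂e²)` (`euler_dss_strain_record_law`):
the package is viscosity-independent except for the twist / Laplacian CREDITS, which are the viscous terms.

§3 THE TANGENT-FLOW DOOR D14.  For a GENERAL (non-self-similar) Type-I singularity the numbers need not be
attained on the solution itself; the KNSS recentring-and-compactness move (proof of their Theorem 6.1: recentre at
near-maximisers, pass to a limit ancient solution which attains the supremum) suggests they are attained on a
TANGENT FLOW.  `TypeIVorticityTangentRecord C₀` types exactly this missing statement — every classical Type-I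
solution on `(−∞,0) × ℝ³` with `ω ≢ 0` has a classical Type-I companion `ū` (a limit of its parabolic rescalings
about the singular point) whose vorticity number is ATTAINED and dominates that of `u` — and
`typeI_vorticity_law_on_tangent_flow` is its kernel-checked consumer: D14 ⇒ every Type-I singularity, DSS or not,
carries a tangent flow on which `1 + (0 − t̄)|∇ξ̄|²_F ≤ (0 − t̄)·ξ̄·S̄ξ̄` at an attained vorticity record.  D14 is
OPEN here (not claimed); its proof path is KNSS §4 regularity (tree: `KNSS2009_regularity_boundedWeak_window_holds`,
Lipschitz-in-time clause for `∇ᵏU`, `k ≥ 1`) + pointwise Arzelà–Ascoli (tree: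
`exists_strictMono_tendsto_of_lipschitzWith`) + the parabolic cone of PART E (near-records cannot escape to spatial
infinity) + identification of the limit as a classical solution (the one piece not in the tree).

hard core evaded: none claimed; D14 is a door, typed, with its consumer proved.
-/

noncomputable section

open MeasureTheory Set Function Filter Metric Real InnerProductSpace
open _root_.Topology
open scoped ENNReal NNReal RealInnerProductSpace ContDiff Laplacian
open Literature.Analysis Literature.Analysis.FluidPDE
open Literature.Analysis.FluidPDE.VorticityDirectionDynamics


namespace Summit.NavierStokesRegularity.NavierStokesRegularity.Theorems.StrainDoors

open Summit.NavierStokesRegularity.NavierStokesRegularity.Theorems.ArgmaxDoors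

/-! ## §1 The vorticity record law without pressure -/

/-- ★ **Vorticity record law, pressure-free form.**  For any solution of the VORTICITY FORMULATION
`IsVorticitySolutionOn S ν u` (`ν ≥ 0`, `S` uniquely differentiable), an interior time `t < T` and a point `x` with
`ω(t,x) ≠ 0` which is a spatial maximum of `|ω(t,·)|` and a left local maximum in time of `s ↦ (T − s)|ω(s,x)|`:
`1 ≤ (T − t)·(⟪ξ, ∇u ξ⟫ − ν|∇ξ|²_F)` at `(t,x)`.  (ROUND 53's `vorticity_record_law` with the classical solution
replaced by its vorticity formulation; the proof is the same: one-sided Fermat + the magnitude identity at the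
spatial maximum.) [folklore] -/
theorem vorticity_record_law_of_vorticitySolution {ν T : ℝ} {S : Set ℝ}
    {u : ℝ → (EuclideanSpace ℝ (Fin 3)) → (EuclideanSpace ℝ (Fin 3))}
    (hν : 0 ≤ ν) (hS : UniqueDiffOn ℝ S) (hV : IsVorticitySolutionOn S ν u)
    {t : ℝ} (ht : S ∈ 𝓝 t) (htT : t < T) {x : EuclideanSpace ℝ (Fin 3)}
    (hmaxX : ∀ y, ‖curl (u t) y‖ ≤ ‖curl (u t) x‖)
    (hmaxT : IsLocalMaxOn (fun s => (T - s) * ‖curl (u s) x‖) (Iic t) t)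
    (hne : curl (u t) x ≠ 0) :
    1 ≤ (T - t) *
      (⟪vorticityDirection (curl (u t)) x, fderiv ℝ (u t) x (vorticityDirection (curl (u t)) x)⟫ -
        ν * frobeniusNormSq (fderiv ℝ (vorticityDirection (curl (u t))) x)) := by
  have ht' : t ∈ S := mem_of_mem_nhds ht
  have hTt : 0 < T - t := sub_pos.mpr htT
  have hv : ContDiff ℝ ∞ (u t) := hV.smooth_velocity.contDiff_slice ht'
  have hvort := hV.vorticity_eq t ht' x
  have h1 := inner_vorticity_rhs_le_at_argmax hν hv hmaxX hne hvort
  have h2 := vorticityNumber_fermat_left hV.smooth_velocity hS ht htT x hmaxT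
  have hpos : 0 < ‖curl (u t) x‖ ^ 2 := pow_pos (norm_pos_iff.mpr hne) 2
  obtain ⟨r, hrdef⟩ : ∃ r : ℝ, r =
      ⟪vorticityDirection (curl (u t)) x, fderiv ℝ (u t) x (vorticityDirection (curl (u t)) x)⟫ -
        ν * frobeniusNormSq (fderiv ℝ (vorticityDirection (curl (u t))) x) := ⟨_, rfl⟩
  rw [← hrdef] at h1 ⊢
  have h3 : ‖curl (u t) x‖ ^ 2 ≤ (T - t) * (r * ‖curl (u t) x‖ ^ 2) :=
    h2.trans (mul_le_mul_of_nonneg_left h1 hTt.le)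
  have h4 : 1 * ‖curl (u t) x‖ ^ 2 ≤ (T - t) * r * ‖curl (u t) x‖ ^ 2 := by
    rw [one_mul, mul_assoc]; exact h3
  exact le_of_mul_le_mul_right h4 hpos

/-- The Euler case (`ν = 0`, `IsEulerVorticitySolutionOn`): at a running space-time record of `(T − t)|ω|` the
stretching rate is at least the clock, `1 ≤ (T − t)·⟪ξ, ∇u ξ⟫`. [folklore] -/
theorem euler_vorticity_record_law {T : ℝ} {S : Set ℝ}
    {u : ℝ → (EuclideanSpace ℝ (Fin 3)) → (EuclideanSpace ℝ (Fin 3))}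
    (hS : UniqueDiffOn ℝ S) (hV : IsEulerVorticitySolutionOn S u)
    {t : ℝ} (ht : S ∈ 𝓝 t) (htT : t < T) {x : EuclideanSpace ℝ (Fin 3)}
    (hmaxX : ∀ y, ‖curl (u t) y‖ ≤ ‖curl (u t) x‖)
    (hmaxT : IsLocalMaxOn (fun s => (T - s) * ‖curl (u s) x‖) (Iic t) t)
    (hne : curl (u t) x ≠ 0) :
    1 ≤ (T - t) * ⟪vorticityDirection (curl (u t)) x, fderiv ℝ (u t) x (vorticityDirection (curl (u t)) x)⟫ := by
  have h := vorticity_record_law_of_vorticitySolution le_rfl hS hV ht htT hmaxX hmaxT hne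
  simpa only [zero_mul, sub_zero] using h

/-! ## §2 The Euler reading of the DSS record laws -/

/-- ★★ **Euler DSS: the vorticity number is attained where stretching beats the clock.**  A classical EULER
solution (`ν = 0`, no force) on `(−∞,0) × ℝ³` which is `c`-DSS about `(0,0)`, whose gradient decays at spatial
infinity uniformly on the period slab `t ∈ [−c², −1]`, and whose vorticity is not identically zero, attains
`W* = max (0 − s)|ω(s,y)|` at a point `(t,x)` where `(0 − t)·⟪ξ, ∇u ξ⟫ ≥ 1`, i.e. `(0 − t)·q(ξ) ≥ 1`.
(`dss_vorticity_record_law` at `ν = 0`.) [new-combination] -/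
theorem euler_dss_vorticity_record_law {c : ℝ} (hc : 1 < c)
    {u : ℝ → (EuclideanSpace ℝ (Fin 3)) → (EuclideanSpace ℝ (Fin 3))} {p : ℝ → (EuclideanSpace ℝ (Fin 3)) → ℝ}
    (hsol : IsClassicalNSSolutionOn (Iio 0) 0 0 u p) (hdss : IsDiscretelySelfSimilar c u)
    (hdecay : ∀ ε : ℝ, 0 < ε → ∃ R : ℝ, ∀ t ∈ Icc (-(c ^ 2)) (-1), ∀ x : EuclideanSpace ℝ (Fin 3),
      R ≤ ‖x‖ → ‖fderiv ℝ (u t) x‖ ≤ ε)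
    (hcurl : ∃ t₀ : ℝ, t₀ < 0 ∧ ∃ x₀ : EuclideanSpace ℝ (Fin 3), curl (u t₀) x₀ ≠ 0) :
    ∃ t : ℝ, t < 0 ∧ ∃ x : EuclideanSpace ℝ (Fin 3), curl (u t) x ≠ 0 ∧
      (∀ s : ℝ, s < 0 → ∀ y : EuclideanSpace ℝ (Fin 3), (0 - s) * ‖curl (u s) y‖ ≤ (0 - t) * ‖curl (u t) x‖) ∧
      1 ≤ (0 - t) * ⟪vorticityDirection (curl (u t)) x, fderiv ℝ (u t) x (vorticityDirection (curl (u t)) x)⟫ ∧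
      ‖vorticityDirection (curl (u t)) x‖ = 1 ∧
      1 ≤ (0 - t) * strainQuad u t x (vorticityDirection (curl (u t)) x) := by
  obtain ⟨t, ht, x, hx, hmax, hlaw, hξ, hq⟩ := dss_vorticity_record_law le_rfl hc hsol hdss hdecay hcurl
  refine ⟨t, ht, x, hx, hmax, ?_, hξ, ?_⟩
  · simpa only [zero_mul, sub_zero] using hlaw
  · simpa only [zero_mul, add_zero] using hq

/-- ★★ **Euler DSS: the strain number is attained, `N* ≥ 1`, with the inviscid strain record law.**  Same class,
with a point of positive strain: the strain number `N* = max (0 − s)λ₁` is attained at `(t,x,e)` and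
`N + N² ≤ (0 − t)²·H`, `H = ¼(|ω|² − ⟪ω,e⟫²) − ∂²p/∂e²` — the Laplacian credit is absent at `ν = 0`.
(`dss_strain_record_law` at `ν = 0`; `N* ≥ 1` from the last conjunct there, or from §2's vorticity law when
`ω ≢ 0`.) [new-combination] -/
theorem euler_dss_strain_record_law {c : ℝ} (hc : 1 < c)
    {u : ℝ → (EuclideanSpace ℝ (Fin 3)) → (EuclideanSpace ℝ (Fin 3))} {p : ℝ → (EuclideanSpace ℝ (Fin 3)) → ℝ}
    (hsol : IsClassicalNSSolutionOn (Iio 0) 0 0 u p) (hdss : IsDiscretelySelfSimilar c u)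
    (hdecay : ∀ ε : ℝ, 0 < ε → ∃ R : ℝ, ∀ t ∈ Icc (-(c ^ 2)) (-1), ∀ x : EuclideanSpace ℝ (Fin 3),
      R ≤ ‖x‖ → ‖fderiv ℝ (u t) x‖ ≤ ε)
    (hpos : ∃ t₀ : ℝ, t₀ < 0 ∧ ∃ x₀ e₀ : EuclideanSpace ℝ (Fin 3), ‖e₀‖ = 1 ∧ 0 < strainQuad u t₀ x₀ e₀) :
    ∃ t : ℝ, t < 0 ∧ ∃ x e : EuclideanSpace ℝ (Fin 3), ‖e‖ = 1 ∧ 0 < strainQuad u t x e ∧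
      (∀ s : ℝ, s < 0 → ∀ y e' : EuclideanSpace ℝ (Fin 3), ‖e'‖ = 1 →
        (0 - s) * strainQuad u s y e' ≤ (0 - t) * strainQuad u t x e) ∧
      (0 - t) * strainQuad u t x e + ((0 - t) * strainQuad u t x e) ^ 2 ≤ (0 - t) ^ 2 * strainFeed u p t x e ∧
      1 ≤ (strainFeed u p t x e - (strainQuad u t x e) ^ 2) / (strainQuad u t x e) ^ 2 *
            ((0 - t) * strainQuad u t x e) := by
  obtain ⟨t, ht, x, e, he, hq, hmax, -, hlaw, hlast⟩ := dss_strain_record_law le_rfl hc hsol hdss hdecay hpos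
  refine ⟨t, ht, x, e, he, hq, hmax, ?_, hlast⟩
  simpa only [zero_mul, sub_zero] using hlaw

/-! ## §3 The tangent-flow door D14 and its consumer -/

/-- **D14 — THE TANGENT-FLOW DOOR (typed; OPEN here).**  For every classical solution `(u,p)` of Navier–Stokes
(`ν = 1`) on `(−∞,0) × ℝ³` with the Type-I bound `|u(t,x)| ≤ C₀/(|x| + √(−t))` and `ω ≢ 0` there is a classical
solution `(ū, p̄)` on `(−∞,0) × ℝ³` with the same Type-I bound — a TANGENT FLOW: the pointwise limit of a sequence
of parabolic rescalings `λ_j u(λ_j² s, λ_j y)` of `u` about the singular point, at the level of vorticities — whose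
vorticity number is ATTAINED at some `(t̄, x̄)`, `ω̄(t̄,x̄) ≠ 0`, and DOMINATES both its own and `u`'s:
`(0 − s)|ω(s,y)|, (0 − s)|ω̄(s,y)| ≤ (0 − t̄)|ω̄(t̄,x̄)|` for all `s < 0`, `y`.
Proof path (not in the tree): near-records of `(0−s)|ω|` lie in a parabolic cone (PART E); recentre by scaling
only; KNSS §4 uniform `C^k` and Lipschitz-in-time bounds for `∇ᵏu`, `k ≥ 1`
(`KNSS2009_regularity_boundedWeak_window_holds`) + pointwise Arzelà–Ascoli
(`exists_strictMono_tendsto_of_lipschitzWith`) + the limit is again a classical Type-I solution (KNSS Lemma 6.1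
in the classical class — the missing piece). [conjecture] -/
def TypeIVorticityTangentRecord (C₀ : ℝ) : Prop :=
  ∀ (u : ℝ → (EuclideanSpace ℝ (Fin 3)) → (EuclideanSpace ℝ (Fin 3))) (p : ℝ → (EuclideanSpace ℝ (Fin 3)) → ℝ),
    IsClassicalNSSolutionOn (Iio 0) 1 0 u p → HasTypeIDecay C₀ u →
    (∃ t₀ : ℝ, t₀ < 0 ∧ ∃ x₀ : EuclideanSpace ℝ (Fin 3), curl (u t₀) x₀ ≠ 0) →
    ∃ (ū : ℝ → (EuclideanSpace ℝ (Fin 3)) → (EuclideanSpace ℝ (Fin 3))) (q : ℝ → (EuclideanSpace ℝ (Fin 3)) → ℝ),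
      IsClassicalNSSolutionOn (Iio 0) 1 0 ū q ∧ HasTypeIDecay C₀ ū ∧
      (∃ lam : ℕ → ℝ, (∀ j, 0 < lam j) ∧ ∀ s : ℝ, s < 0 → ∀ y : EuclideanSpace ℝ (Fin 3),
        Tendsto (fun j => (lam j) ^ 2 • curl (u ((lam j) ^ 2 * s)) ((lam j) • y)) atTop
          (𝓝 (curl (ū s) y))) ∧
      ∃ t : ℝ, t < 0 ∧ ∃ x : EuclideanSpace ℝ (Fin 3), curl (ū t) x ≠ 0 ∧
        (∀ s : ℝ, s < 0 → ∀ y : EuclideanSpace ℝ (Fin 3), (0 - s) * ‖curl (u s) y‖ ≤ (0 - t) * ‖curl (ū t) x‖) ∧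
        (∀ s : ℝ, s < 0 → ∀ y : EuclideanSpace ℝ (Fin 3), (0 - s) * ‖curl (ū s) y‖ ≤ (0 - t) * ‖curl (ū t) x‖)

/-- ★★ **Consumer of D14: every Type-I singularity carries the vorticity record law on a tangent flow.**  Assume
`TypeIVorticityTangentRecord C₀`.  Then every classical Type-I solution `(u,p)` on `(−∞,0) × ℝ³` (constant `C₀`)
with `ω ≢ 0` — self-similar OR NOT — has a classical Type-I tangent flow `(ū, p̄)` whose vorticity number
`W̄ = (0 − t̄)|ω̄(t̄,x̄)| ≥ sup (0 − s)|ω(s,y)|` is attained at a point where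
`1 ≤ (0 − t̄)(⟪ξ̄, ∇ū ξ̄⟫ − |∇ξ̄|²_F)` and `1 + (0 − t̄)|∇ξ̄|²_F ≤ (0 − t̄)·q̄(ξ̄)`: stretching beats the clock plus
the twist ON THE TANGENT FLOW.  (D14 + ROUND 53's running record law.) [new-combination] -/
theorem typeI_vorticity_law_on_tangent_flow {C₀ : ℝ} (hD : TypeIVorticityTangentRecord C₀)
    {u : ℝ → (EuclideanSpace ℝ (Fin 3)) → (EuclideanSpace ℝ (Fin 3))} {p : ℝ → (EuclideanSpace ℝ (Fin 3)) → ℝ}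
    (hsol : IsClassicalNSSolutionOn (Iio 0) 1 0 u p) (hI : HasTypeIDecay C₀ u)
    (hcurl : ∃ t₀ : ℝ, t₀ < 0 ∧ ∃ x₀ : EuclideanSpace ℝ (Fin 3), curl (u t₀) x₀ ≠ 0) :
    ∃ (ū : ℝ → (EuclideanSpace ℝ (Fin 3)) → (EuclideanSpace ℝ (Fin 3))) (q : ℝ → (EuclideanSpace ℝ (Fin 3)) → ℝ),
      IsClassicalNSSolutionOn (Iio 0) 1 0 ū q ∧ HasTypeIDecay C₀ ū ∧
      ∃ t : ℝ, t < 0 ∧ ∃ x : EuclideanSpace ℝ (Fin 3), curl (ū t) x ≠ 0 ∧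
        (∀ s : ℝ, s < 0 → ∀ y : EuclideanSpace ℝ (Fin 3), (0 - s) * ‖curl (u s) y‖ ≤ (0 - t) * ‖curl (ū t) x‖) ∧
        1 ≤ (0 - t) *
          (⟪vorticityDirection (curl (ū t)) x, fderiv ℝ (ū t) x (vorticityDirection (curl (ū t)) x)⟫ -
            frobeniusNormSq (fderiv ℝ (vorticityDirection (curl (ū t))) x)) ∧
        1 + (0 - t) * frobeniusNormSq (fderiv ℝ (vorticityDirection (curl (ū t))) x) ≤
          (0 - t) * strainQuad ū t x (vorticityDirection (curl (ū t)) x) := by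
  obtain ⟨ū, q, hsol', hI', -, t, ht, x, hx, hdomU, hdom⟩ := hD u p hsol hI hcurl
  have hS : UniqueDiffOn ℝ (Iio (0 : ℝ)) := uniqueDiffOn_Iio 0
  have htn : Iio (0 : ℝ) ∈ 𝓝 t := Iio_mem_nhds ht
  have hrec : ∀ᶠ s in 𝓝[≤] t, ∀ y : EuclideanSpace ℝ (Fin 3),
      (0 - s) * ‖curl (ū s) y‖ ≤ (0 - t) * ‖curl (ū t) x‖ := by
    filter_upwards [mem_nhdsWithin_of_mem_nhds htn] with s hs y
    exact hdom s hs y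
  have hlaw := vorticity_running_record_law zero_le_one hS hsol' htn ht hrec hx
  rw [one_mul] at hlaw
  refine ⟨ū, q, hsol', hI', t, ht, x, hx, hdomU, hlaw, ?_⟩
  have hq : strainQuad ū t x (vorticityDirection (curl (ū t)) x) =
      ⟪vorticityDirection (curl (ū t)) x, fderiv ℝ (ū t) x (vorticityDirection (curl (ū t)) x)⟫ := by
    unfold strainQuad; exact real_inner_comm _ _
  rw [hq]
  nlinarith

end Summit.NavierStokesRegularity.NavierStokesRegularity.Theorems.StrainDoors

end
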